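import Literature.Topology.FourManifolds.KhConnSumMerge
import Literature.Topology.FourManifolds.RasmussenSliceCanonicalProofs
import Literature.Topology.FourManifolds.LeeRasmussenMirrorDischarge
import HarnessLib

/-!
# Lee coordinates of a connected sum and the additivity of Rasmussen's `s` for diagrams

Fourth brick (after `GaussDiagramsConnSum`, `KhConnSumStates`, `KhConnSumMerge`) of the
diagrammatic additivity of Rasmussen's invariant: **`s(D₁ # D₂) = s(D₁) + s(D₂)`** for Gauss
diagrams satisfying Gauss's parity condition (Rasmussen (2010), Prop. 3.11; the combinatorial
content of the named fact `HasRasmussenInvariant.add` of `Rasmussen.lean`, whose remaining input is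
the geometric realisation of `D₁ # D₂` by a connected sum of knots).

* `§ Glue`: enhanced states of `G # H` glued from enhanced states of the blocks with matching
  labels on the base circles (`glue`); Lee's canonical states of `G # H` are glued from those of
  the blocks (`glue_leeState`).
* `§ LeeCoord`: **Lee's coordinates are multiplicative under the merge map**
  (`leeCoord_mergeMap_glue`): the pairing of `m(x, y)` with the Lee monomial glued from monomials
  `u₁`, `u₂` is `leeSign · ⟨x, u₁⟩ · ⟨y, u₂⟩` — in Lee's basis `𝐚, 𝐛` the multiplication is diagonal
  (`𝐚𝐚 = 2𝐚`, `𝐛𝐛 = -2𝐛`, `𝐚𝐛 = 0`: Lee (2005), §4; Rasmussen (2010), §2.4).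
* `§ Lee`: Lee's theorem (dimension two, spanning by the canonical generators) under the
  merge/split dichotomy, per diagram (the tree's `LeeRasmussenRankProofs` /
  `RasmussenSliceCanonicalProofs` state these for realisable diagrams; the proofs are the same); the
  `X`-operator is diagonal in Lee's coordinates (`leeCoord_leeX`) and the canonical generators are
  its eigenvectors (`leeX_leeCoord_symm_single`); `s_max` is attained by a homogeneous class
  (`exists_qProjBar_eq_classDegree_eq_leeSMax`); and **a nonzero homogeneous class has both
  canonical coordinates nonzero** (`leeCoord_leeState_ne_zero_of_qProjBar_eq`).
* `§ Additivity`: the lower bound `s(G # H) ≥ s(G) + s(H)` from the merge map (a cycle of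
  filtration degree `≥ s_max(G) + s_max(H) - 1` which is not a boundary,
  `add_le_rasmussenInvariant_connSum`), the upper bound from the mirror images
  (`GaussDiagram.mirror_connSum`, `s(Ḡ) = -s(G)` per diagram, `rasmussenInvariant_mirror_of_parity_self`),
  and the theorem `rasmussenInvariant_connSum` (both summands with a chord;
  `rasmussenInvariant_connSum_of_pos_left` allows an empty second summand).

Everything is proved; no named fact is introduced. Hypotheses are Gauss's parity condition
(`∀ i, overPos i % 2 ≠ underPos i % 2`, i.e. `GaussDiagram.AllEven`, automatic for diagrams of
knots), never realisability.

## References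

* J. Rasmussen, *Khovanov homology and the slice genus*, Invent. Math. 182 (2010) 419–447
  (arXiv:math/0402131): §2.4 (Lee's basis), Lemma 3.5, Lemma 3.8, Prop. 3.9, Prop. 3.11.
  [cite: Rasmussen2010, Prop. 3.11]
* E. S. Lee, *An endomorphism of the Khovanov invariant*, Adv. Math. 197 (2005) 554–586, §4,
  Thm. 4.2. [cite: Lee2005, Thm. 4.2]
* M. Khovanov, *A categorification of the Jones polynomial*, Duke Math. J. 101 (2000), §7.4.
  [cite: Khovanov2000, §7.4]
-/

open Function Finset

noncomputable section

namespace Literature.Topology.FourManifolds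

namespace GaussDiagram

variable (G H : GaussDiagram) (hG : 0 < G.n) (hH : 0 < H.n)

/-! ## Glue: enhanced states of `G # H` from enhanced states of the blocks -/

section Glue

/-- The labelling of the arcs of `G # H` glued from labellings of the blocks. [folklore] -/
def glueLab (ℓ₁ : G.Arc → Bool) (ℓ₂ : H.Arc → Bool) : (G.connSum H).Arc → Bool :=
  Sum.elim ℓ₁ ℓ₂ ∘ (G.arcEquiv H hG hH).symm

/-- The glued labelling on the first block. [folklore] -/
@[simp] theorem glueLab_inlArc (ℓ₁ : G.Arc → Bool) (ℓ₂ : H.Arc → Bool) (a : G.Arc) :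
    G.glueLab H hG hH ℓ₁ ℓ₂ (G.inlArc H a) = ℓ₁ a := by
  change Sum.elim ℓ₁ ℓ₂ ((G.arcEquiv H hG hH).symm (G.arcEquiv H hG hH (Sum.inl a))) = ℓ₁ a
  rw [Equiv.symm_apply_apply, Sum.elim_inl]

/-- The glued labelling on the second block. [folklore] -/
@[simp] theorem glueLab_inrArc (ℓ₁ : G.Arc → Bool) (ℓ₂ : H.Arc → Bool) (b : H.Arc) :
    G.glueLab H hG hH ℓ₁ ℓ₂ (G.inrArc H b) = ℓ₂ b := by
  change Sum.elim ℓ₁ ℓ₂ ((G.arcEquiv H hG hH).symm (G.arcEquiv H hG hH (Sum.inr b))) = ℓ₂ b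
  rw [Equiv.symm_apply_apply, Sum.elim_inr]

/-- The glued labelling read on blocks. [folklore] -/
@[simp] theorem glueLab_comp_arcEquiv (ℓ₁ : G.Arc → Bool) (ℓ₂ : H.Arc → Bool) :
    G.glueLab H hG hH ℓ₁ ℓ₂ ∘ G.arcEquiv H hG hH = Sum.elim ℓ₁ ℓ₂ := by
  funext x
  simp [glueLab]

/-- **Labellings glue**: labellings of `σ₁` and of `σ₂` which agree on the two base arcs glue to a
labelling of `(σ₁, σ₂)` in `G # H` (the circles of `G # H` are those of the blocks with the base
circles united, `GaussDiagram.connSum_surg`). [folklore] -/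
theorem isLabelOf_glueLab {σ₁ : G.State} {σ₂ : H.State} {ℓ₁ : G.Arc → Bool} {ℓ₂ : H.Arc → Bool}
    (h₁ : G.IsLabelOf σ₁ ℓ₁) (h₂ : H.IsLabelOf σ₂ ℓ₂) (hb : ℓ₁ G.baseArc = ℓ₂ H.baseArc) :
    (G.connSum H).IsLabelOf (Fin.append σ₁ σ₂) (G.glueLab H hG hH ℓ₁ ℓ₂) := by
  intro a b hab
  obtain ⟨x, rfl⟩ := (G.arcEquiv H hG hH).surjective a
  obtain ⟨y, rfl⟩ := (G.arcEquiv H hG hH).surjective b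
  have hc : ((G.connSum H).circleOf (Fin.append σ₁ σ₂) ∘ G.arcEquiv H hG hH) x =
      ((G.connSum H).circleOf (Fin.append σ₁ σ₂) ∘ G.arcEquiv H hG hH) y :=
    SimpleGraph.ConnectedComponent.sound hab.reachable
  have hval : ∀ z, G.glueLab H hG hH ℓ₁ ℓ₂ (G.arcEquiv H hG hH z) = Sum.elim ℓ₁ ℓ₂ z := fun z ↦ by
    simp [glueLab]
  rw [hval, hval]
  have h₁' := lab_of_isLabelOf h₁
  have h₂' := lab_of_isLabelOf h₂
  rcases ((G.connSum_surg H σ₁ σ₂ hG hH).rel x y).1 hc with h | ⟨hx, hy⟩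
  · rcases x with x | x <;> rcases y with y | y
    · exact h₁' x y (by simpa using h)
    · simp at h
    · simp at h
    · exact h₂' x y (by simpa using h)
  · have hval' : ∀ z, (Sum.map (G.circleOf σ₁) (H.circleOf σ₂) z = Sum.map (G.circleOf σ₁) (H.circleOf σ₂) (Sum.inl G.baseArc) ∨
        Sum.map (G.circleOf σ₁) (H.circleOf σ₂) z = Sum.map (G.circleOf σ₁) (H.circleOf σ₂) (Sum.inr H.baseArc)) →
        Sum.elim ℓ₁ ℓ₂ z = ℓ₁ G.baseArc := by
      rintro (z | z) (hz | hz)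
      · exact h₁' z _ (by simpa using hz)
      · simp at hz
      · simp at hz
      · rw [hb]; exact h₂' z _ (by simpa using hz)
    rw [hval' x hx, hval' y hy]

variable {G H} in
/-- **Gluing enhanced states**: enhanced states of `G` and of `H` with the same label on the two
base circles give an enhanced state of `G # H` over the pair of states. [folklore] -/
def glue (u₁ : G.EnhancedState) (u₂ : H.EnhancedState) (hb : u₁.label G.baseArc = u₂.label H.baseArc) :
    (G.connSum H).EnhancedState :=
  ⟨Fin.append u₁.state u₂.state, G.glueLab H hG hH u₁.label u₂.label,
    G.isLabelOf_glueLab H hG hH u₁.isLabelOf u₂.isLabelOf hb⟩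

/-- The state of a glued enhanced state. [folklore] -/
@[simp] theorem glue_state (u₁ : G.EnhancedState) (u₂ : H.EnhancedState)
    (hb : u₁.label G.baseArc = u₂.label H.baseArc) :
    (glue hG hH u₁ u₂ hb).state = Fin.append u₁.state u₂.state := rfl

/-- The labelling of a glued enhanced state. [folklore] -/
@[simp] theorem glue_label (u₁ : G.EnhancedState) (u₂ : H.EnhancedState)
    (hb : u₁.label G.baseArc = u₂.label H.baseArc) :
    (glue hG hH u₁ u₂ hb).label = G.glueLab H hG hH u₁.label u₂.label := rfl

/-- **Homological degrees add under gluing.** [folklore] -/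
theorem homDegree_glue (u₁ : G.EnhancedState) (u₂ : H.EnhancedState)
    (hb : u₁.label G.baseArc = u₂.label H.baseArc) :
    homDegree (glue hG hH u₁ u₂ hb) = homDegree u₁ + homDegree u₂ := by
  simp only [homDegree, glue_state, weight_append, nMinus_connSum]
  push_cast
  ring

variable {G H} in
/-- The glued enhanced state of two degree-zero enhanced states, in degree zero. [folklore] -/
def glue₀ (u₁ : G.degStates 0) (u₂ : H.degStates 0) (hb : u₁.1.label G.baseArc = u₂.1.label H.baseArc) :
    (G.connSum H).degStates 0 :=
  ⟨glue hG hH u₁.1 u₂.1 hb, by rw [homDegree_glue, u₁.2, u₂.2, add_zero]⟩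

/-- **The Seifert state of `G # H` is the pair of Seifert states.** [folklore] -/
theorem seifertState_connSum : (G.connSum H).seifertState = Fin.append G.seifertState H.seifertState := by
  funext k
  induction k using Fin.addCases with
  | left i => simp [seifertState]
  | right j => simp [seifertState]

/-- **The alternating labellings of `G # H` are glued from those of the blocks** (an arc of a
block keeps the parity of its number in `G # H`, the shift `2 n₁` being even). [folklore] -/
theorem altLabel_connSum (t : Bool) :
    (G.connSum H).altLabel t = G.glueLab H hG hH (G.altLabel t) (H.altLabel t) := by
  funext r
  obtain ⟨x, rfl⟩ := (G.arcEquiv H hG hH).surjective r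
  rcases x with a | b
  · rw [arcEquiv_inl, glueLab_inlArc]
    simp [altLabel]
  · rw [arcEquiv_inr, glueLab_inrArc]
    simp only [altLabel, inrArc_val G H hH]
    rw [show (2 * G.n + (b : ℕ)) % 2 = (b : ℕ) % 2 by omega]

/-- **Lee's canonical states of `G # H` are glued from those of the blocks** (same label `t` on
the arcs leaving the base points). Rasmussen (2010), §2.4, Prop. 3.11 ("`Kh'(K₁ # K₂)` has a
canonical generator which maps to `𝔰_a ⊗ 𝔰_b`"). [cite: Rasmussen2010, Prop. 3.11] -/
theorem glue_leeState (hpG : ∀ i, (G.overPos i).val % 2 ≠ (G.underPos i).val % 2)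
    (hpH : ∀ j, (H.overPos j).val % 2 ≠ (H.underPos j).val % 2)
    (hpD : ∀ k, ((G.connSum H).overPos k).val % 2 ≠ ((G.connSum H).underPos k).val % 2) (t : Bool)
    (hb : (G.leeState hpG t).label G.baseArc = (H.leeState hpH t).label H.baseArc) :
    glue hG hH (G.leeState hpG t) (H.leeState hpH t) hb = (G.connSum H).leeState hpD t := by
  refine EnhancedState.ext' ?_ ?_
  · exact (G.seifertState_connSum H).symm
  · exact (G.altLabel_connSum H hG hH t).symm

include hG hH in
/-- The labels of Lee's canonical states of `G` and `H` agree on the base arcs (both have the odd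
number `2 n - 1`). [folklore] -/
theorem leeState_label_baseArc (hpG : ∀ i, (G.overPos i).val % 2 ≠ (G.underPos i).val % 2)
    (hpH : ∀ j, (H.overPos j).val % 2 ≠ (H.underPos j).val % 2) (t : Bool) :
    (G.leeState hpG t).label G.baseArc = (H.leeState hpH t).label H.baseArc := by
  have h1 : (2 * G.n - 1) % 2 = 1 := by omega
  have h2 : (2 * H.n - 1) % 2 = 1 := by omega
  simp [leeState, altLabel, val_baseArc, h1, h2]

end Glue

/-! ## Lee's coordinates are multiplicative under the merge map -/

section LeeCoord

variable {σ₁ : G.State} {σ₂ : H.State}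

/-- The labelling of `(σ₁, σ₂)` in `G # H` obtained from labellings of the blocks by putting the
label `v` on the merged base circle (`KhFace.upd` along `GaussDiagram.connSum_surg`), read on the
arcs of `G # H`. [folklore] -/
def mergedLab (lam₁ : G.Arc → Bool) (lam₂ : H.Arc → Bool) (v : Bool) : (G.connSum H).Arc → Bool :=
  KhFace.upd ((G.connSum H).circleOf (Fin.append σ₁ σ₂) ∘ G.arcEquiv H hG hH) (Sum.elim lam₁ lam₂)
      (Sum.inl G.baseArc) v ∘ (G.arcEquiv H hG hH).symm

/-- The merged labelling read on blocks. [folklore] -/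
theorem mergedLab_comp_arcEquiv (lam₁ : G.Arc → Bool) (lam₂ : H.Arc → Bool) (v : Bool) :
    G.mergedLab H hG hH (σ₁ := σ₁) (σ₂ := σ₂) lam₁ lam₂ v ∘ G.arcEquiv H hG hH =
      KhFace.upd ((G.connSum H).circleOf (Fin.append σ₁ σ₂) ∘ G.arcEquiv H hG hH) (Sum.elim lam₁ lam₂)
        (Sum.inl G.baseArc) v := by
  funext x
  simp [mergedLab]

/-- The merged labelling on a first-block arc: `v` on the base circle, `lam₁` elsewhere. [folklore] -/
theorem mergedLab_inlArc (lam₁ : G.Arc → Bool) (lam₂ : H.Arc → Bool) (v : Bool) (a : G.Arc) :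
    G.mergedLab H hG hH (σ₁ := σ₁) (σ₂ := σ₂) lam₁ lam₂ v (G.inlArc H a) =
      if G.circleOf σ₁ a = G.circleOf σ₁ G.baseArc then v else lam₁ a := by
  have : G.mergedLab H hG hH (σ₁ := σ₁) (σ₂ := σ₂) lam₁ lam₂ v (G.arcEquiv H hG hH (Sum.inl a)) = _ :=
    congrFun (G.mergedLab_comp_arcEquiv H hG hH (σ₁ := σ₁) (σ₂ := σ₂) lam₁ lam₂ v) (Sum.inl a)
  rw [arcEquiv_inl] at this
  rw [this]
  unfold KhFace.upd
  simp only [Function.comp_apply, arcEquiv_inl, Sum.elim_inl]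
  by_cases h : G.circleOf σ₁ a = G.circleOf σ₁ G.baseArc
  · rw [if_pos h, if_pos ((G.circleOf_inlArc_eq_iff H σ₁ σ₂ hG hH a G.baseArc).2 h)]
  · rw [if_neg h, if_neg (fun h' ↦ h ((G.circleOf_inlArc_eq_iff H σ₁ σ₂ hG hH a G.baseArc).1 h'))]

/-- The merged labelling on a second-block arc: `v` on the base circle, `lam₂` elsewhere. [folklore] -/
theorem mergedLab_inrArc (lam₁ : G.Arc → Bool) (lam₂ : H.Arc → Bool) (v : Bool) (b : H.Arc) :
    G.mergedLab H hG hH (σ₁ := σ₁) (σ₂ := σ₂) lam₁ lam₂ v (G.inrArc H b) =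
      if H.circleOf σ₂ b = H.circleOf σ₂ H.baseArc then v else lam₂ b := by
  have : G.mergedLab H hG hH (σ₁ := σ₁) (σ₂ := σ₂) lam₁ lam₂ v (G.arcEquiv H hG hH (Sum.inr b)) = _ :=
    congrFun (G.mergedLab_comp_arcEquiv H hG hH (σ₁ := σ₁) (σ₂ := σ₂) lam₁ lam₂ v) (Sum.inr b)
  rw [arcEquiv_inr] at this
  rw [this]
  unfold KhFace.upd
  simp only [Function.comp_apply, arcEquiv_inl, arcEquiv_inr, Sum.elim_inr]
  by_cases h : H.circleOf σ₂ b = H.circleOf σ₂ H.baseArc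
  · rw [if_pos h, if_pos ((G.circleOf_inlArc_eq_inrArc_iff H σ₁ σ₂ hG hH G.baseArc b).2 ⟨rfl, h⟩).symm]
  · rw [if_neg h, if_neg (fun h' ↦ h ((G.circleOf_inlArc_eq_inrArc_iff H σ₁ σ₂ hG hH G.baseArc b).1 h'.symm).2)]

/-- The merged labelling is a labelling of `(σ₁, σ₂)`. [folklore] -/
theorem isLabelOf_mergedLab {lam₁ : G.Arc → Bool} {lam₂ : H.Arc → Bool} (h₁ : G.IsLabelOf σ₁ lam₁)
    (h₂ : H.IsLabelOf σ₂ lam₂) (v : Bool) :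
    (G.connSum H).IsLabelOf (Fin.append σ₁ σ₂) (G.mergedLab H hG hH (σ₁ := σ₁) (σ₂ := σ₂) lam₁ lam₂ v) := by
  have hla : ∀ x y, Sum.map (G.circleOf σ₁) (H.circleOf σ₂) x = Sum.map (G.circleOf σ₁) (H.circleOf σ₂) y →
      Sum.elim lam₁ lam₂ x = Sum.elim lam₁ lam₂ y := by
    rintro (x | x) (y | y) hxy
    · exact lab_of_isLabelOf h₁ x y (by simpa using hxy)
    · simp at hxy
    · simp at hxy
    · exact lab_of_isLabelOf h₂ x y (by simpa using hxy)
  have hmem := KhFace.upd_mem_lab (G.connSum_surg H σ₁ σ₂ hG hH) ⟨Sum.elim lam₁ lam₂, hla⟩ v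
  intro a b hab
  obtain ⟨x, rfl⟩ := (G.arcEquiv H hG hH).surjective a
  obtain ⟨y, rfl⟩ := (G.arcEquiv H hG hH).surjective b
  have hc : ((G.connSum H).circleOf (Fin.append σ₁ σ₂) ∘ G.arcEquiv H hG hH) x =
      ((G.connSum H).circleOf (Fin.append σ₁ σ₂) ∘ G.arcEquiv H hG hH) y :=
    SimpleGraph.ConnectedComponent.sound hab.reachable
  have := hmem x y hc
  simpa [mergedLab] using this

/-- **Signs across the connected sum.** For labellings `lam₁`, `ℓ₁` of `σ₁` and `lam₂`, `ℓ₂` of `σ₂`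
with `ℓ₁`, `ℓ₂` agreeing on the base arcs (common value `w`), putting `v` on the merged base circle:
`(-1)^{pairCount (σ₁ # σ₂) (lam[base ↦ v]) (ℓ₁ # ℓ₂)} = (-1)^{pairCount σ₁ lam₁ ℓ₁} (-1)^{pairCount σ₂ lam₂ ℓ₂} s(v, w) s(lam₁ B₁, w) s(lam₂ B₂, w)`
(the circles of `σ₁ # σ₂` are those of the blocks with the two base circles `B₁`, `B₂` replaced
by one; cf. `neg_one_pow_pairCount_merge`). [folklore] -/
theorem neg_one_pow_pairCount_mergedLab {lam₁ ell₁ : G.Arc → Bool} {lam₂ ell₂ : H.Arc → Bool}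
    (hl₁ : G.IsLabelOf σ₁ lam₁) (he₁ : G.IsLabelOf σ₁ ell₁) (hl₂ : H.IsLabelOf σ₂ lam₂)
    (he₂ : H.IsLabelOf σ₂ ell₂) (hb : ell₁ G.baseArc = ell₂ H.baseArc) (v : Bool) :
    (-1 : ℚ) ^ (G.connSum H).pairCount (Fin.append σ₁ σ₂)
        (G.mergedLab H hG hH (σ₁ := σ₁) (σ₂ := σ₂) lam₁ lam₂ v) (G.glueLab H hG hH ell₁ ell₂) =
      (-1 : ℚ) ^ G.pairCount σ₁ lam₁ ell₁ * (-1 : ℚ) ^ H.pairCount σ₂ lam₂ ell₂ *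
        pairSign v (ell₁ G.baseArc) * pairSign (lam₁ G.baseArc) (ell₁ G.baseArc) *
        pairSign (lam₂ H.baseArc) (ell₁ G.baseArc) := by
  classical
  have hμ := G.isLabelOf_mergedLab H hG hH (σ₁ := σ₁) (σ₂ := σ₂) hl₁ hl₂ v
  have hℓ := G.isLabelOf_glueLab H hG hH (σ₁ := σ₁) (σ₂ := σ₂) he₁ he₂ hb
  rw [neg_one_pow_pairCount hμ hℓ, neg_one_pow_pairCount hl₁ he₁, neg_one_pow_pairCount hl₂ he₂]
  -- the factors
  set F : (G.connSum H).StateCircle (Fin.append σ₁ σ₂) → ℚ := fun C ↦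
    if (!(G.connSum H).liftLabel (Fin.append σ₁ σ₂) _ hμ C &&
        (G.connSum H).liftLabel (Fin.append σ₁ σ₂) _ hℓ C) = true then (-1 : ℚ) else 1 with hF
  set g₁ : G.StateCircle σ₁ → ℚ := fun C ↦
    if (!G.liftLabel σ₁ lam₁ hl₁ C && G.liftLabel σ₁ ell₁ he₁ C) = true then (-1 : ℚ) else 1 with hg₁
  set g₂ : H.StateCircle σ₂ → ℚ := fun C ↦
    if (!H.liftLabel σ₂ lam₂ hl₂ C && H.liftLabel σ₂ ell₂ he₂ C) = true then (-1 : ℚ) else 1 with hg₂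
  change (∏ C, F C) = (∏ C, g₁ C) * (∏ C, g₂ C) * _ * _ * _
  -- values of `F` on the images of the block circles
  have hF₁ : ∀ a, F (G.inlCircle H σ₁ σ₂ hG hH (G.circleOf σ₁ a)) =
      if G.circleOf σ₁ a = G.circleOf σ₁ G.baseArc then pairSign v (ell₁ G.baseArc)
      else pairSign (lam₁ a) (ell₁ a) := by
    intro a
    simp only [hF, inlCircle_circleOf, liftLabel_circleOf, mergedLab_inlArc, glueLab_inlArc, pairSign]
    by_cases ha : G.circleOf σ₁ a = G.circleOf σ₁ G.baseArc
    · rw [if_pos ha, if_pos ha, lab_of_isLabelOf he₁ a G.baseArc ha]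
    · rw [if_neg ha, if_neg ha]
  have hF₂ : ∀ b, F (G.inrCircle H σ₁ σ₂ hG hH (H.circleOf σ₂ b)) =
      if H.circleOf σ₂ b = H.circleOf σ₂ H.baseArc then pairSign v (ell₁ G.baseArc)
      else pairSign (lam₂ b) (ell₂ b) := by
    intro b
    simp only [hF, inrCircle_circleOf, liftLabel_circleOf, mergedLab_inrArc, glueLab_inrArc, pairSign]
    by_cases hb' : H.circleOf σ₂ b = H.circleOf σ₂ H.baseArc
    · rw [if_pos hb', if_pos hb', lab_of_isLabelOf he₂ b H.baseArc hb', ← hb]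
    · rw [if_neg hb', if_neg hb']
  have hg₁v : ∀ a, g₁ (G.circleOf σ₁ a) = pairSign (lam₁ a) (ell₁ a) := fun a ↦ by
    simp only [hg₁, liftLabel_circleOf, pairSign]
  have hg₂v : ∀ b, g₂ (H.circleOf σ₂ b) = pairSign (lam₂ b) (ell₂ b) := fun b ↦ by
    simp only [hg₂, liftLabel_circleOf, pairSign]
  -- block products with the base circle split off
  have hP₁ : (∏ C, F (G.inlCircle H σ₁ σ₂ hG hH C)) =
      pairSign v (ell₁ G.baseArc) * ∏ C ∈ Finset.univ.erase (G.circleOf σ₁ G.baseArc), g₁ C := by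
    rw [← Finset.mul_prod_erase _ _ (Finset.mem_univ (G.circleOf σ₁ G.baseArc)), hF₁, if_pos rfl]
    congr 1
    refine Finset.prod_congr rfl fun C hC ↦ ?_
    rw [Finset.mem_erase] at hC
    induction C using SimpleGraph.ConnectedComponent.ind with | h a => ?_
    change F (G.inlCircle H σ₁ σ₂ hG hH (G.circleOf σ₁ a)) = g₁ (G.circleOf σ₁ a)
    rw [hF₁, if_neg (show ¬ G.circleOf σ₁ a = G.circleOf σ₁ G.baseArc from hC.1), hg₁v]
  have hQ₁ : (∏ C, g₁ C) = pairSign (lam₁ G.baseArc) (ell₁ G.baseArc) *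
      ∏ C ∈ Finset.univ.erase (G.circleOf σ₁ G.baseArc), g₁ C := by
    rw [← Finset.mul_prod_erase _ _ (Finset.mem_univ (G.circleOf σ₁ G.baseArc)), hg₁v]
  have hP₂ : (∏ C, F (G.inrCircle H σ₁ σ₂ hG hH C)) =
      pairSign v (ell₁ G.baseArc) * ∏ C ∈ Finset.univ.erase (H.circleOf σ₂ H.baseArc), g₂ C := by
    rw [← Finset.mul_prod_erase _ _ (Finset.mem_univ (H.circleOf σ₂ H.baseArc)), hF₂, if_pos rfl]
    congr 1
    refine Finset.prod_congr rfl fun C hC ↦ ?_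
    rw [Finset.mem_erase] at hC
    induction C using SimpleGraph.ConnectedComponent.ind with | h b => ?_
    change F (G.inrCircle H σ₁ σ₂ hG hH (H.circleOf σ₂ b)) = g₂ (H.circleOf σ₂ b)
    rw [hF₂, if_neg (show ¬ H.circleOf σ₂ b = H.circleOf σ₂ H.baseArc from hC.1), hg₂v]
  have hQ₂ : (∏ C, g₂ C) = pairSign (lam₂ H.baseArc) (ell₁ G.baseArc) *
      ∏ C ∈ Finset.univ.erase (H.circleOf σ₂ H.baseArc), g₂ C := by
    rw [← Finset.mul_prod_erase _ _ (Finset.mem_univ (H.circleOf σ₂ H.baseArc)), hg₂v, hb]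
  -- the product over the circles of `G # H`
  have hprod := G.prod_stateCircle_connSum H σ₁ σ₂ hG hH F
  rw [hF₁, if_pos rfl, hP₁, hP₂] at hprod
  rw [hQ₁, hQ₂]
  have hs := pairSign_mul_self v (ell₁ G.baseArc)
  have hs₁ := pairSign_mul_self (lam₁ G.baseArc) (ell₁ G.baseArc)
  have hs₂ := pairSign_mul_self (lam₂ H.baseArc) (ell₁ G.baseArc)
  set s := pairSign v (ell₁ G.baseArc)
  set s₁ := pairSign (lam₁ G.baseArc) (ell₁ G.baseArc)
  set s₂ := pairSign (lam₂ H.baseArc) (ell₁ G.baseArc)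
  set P₁ := ∏ C ∈ Finset.univ.erase (G.circleOf σ₁ G.baseArc), g₁ C
  set P₂ := ∏ C ∈ Finset.univ.erase (H.circleOf σ₂ H.baseArc), g₂ C
  -- `(∏ F) s = s² P₁ P₂`, `s² = s₁² = s₂² = 1`
  linear_combination s * hprod + (-(∏ C, F C) + s * P₁ * P₂) * hs - (s * P₁ * P₂ * (s₂ * s₂)) * hs₁ -
    (s * P₁ * P₂) * hs₂

/-- **Summing over the fibre of a state.** A function on the degree-`k` enhanced states vanishing
off the enhanced states over `τ` sums to its sum over the labellings of the circles of `τ`.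
[folklore] -/
theorem sum_degStates_eq_sum_lab {K : GaussDiagram} (k : ℤ) (τ : K.State) (hk : (τ.weight : ℤ) - K.nMinus = k)
    (f : K.degStates k → ℚ) (hf : ∀ s, s.1.state ≠ τ → f s = 0) :
    ∑ s, f s = ∑ mu : KhFace.Lab (K.circleOf τ), f ((K.stateFibreLabEquiv k τ hk).symm mu).1 := by
  classical
  rw [← Finset.sum_subset (Finset.filter_subset (fun s : K.degStates k ↦ s.1.state = τ) Finset.univ)
    (fun s _ hs ↦ hf s (by simpa using hs)),
    Finset.sum_subtype (Finset.univ.filter fun s : K.degStates k ↦ s.1.state = τ)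
      (p := fun s : K.degStates k ↦ s.1.state = τ) (fun s ↦ by simp)]
  exact Fintype.sum_equiv (K.stateFibreLabEquiv k τ hk) _ _ (fun s ↦ by simp)

/-- **Lee's coordinates as a sum over labellings**: the pairing of a cochain `x` with the Lee
monomial `u = (τ, ℓ)` is `Σ_μ (-1)^{pairCount τ μ ℓ} x(τ, μ)` over the labellings `μ` of `τ`.
Lee (2005), §4.4. [cite: Lee2005, §4.4] -/
theorem leeCoord_apply_eq_sum_lab {K : GaussDiagram} (k : ℤ) (x : K.degStates k → ℚ) (u : K.degStates k) :
    K.leeCoord k x u = ∑ mu : KhFace.Lab (K.circleOf u.1.state),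
      (-1 : ℚ) ^ K.pairCount u.1.state mu.1 u.1.label *
        x ((K.stateFibreLabEquiv k u.1.state (by have := u.2; rwa [homDegree] at this)).symm mu).1 := by
  classical
  rw [leeCoord_apply, Matrix.toLin'_apply]
  simp only [Matrix.mulVec, dotProduct, Matrix.transpose_apply, leeBasisMat, Matrix.of_apply]
  rw [sum_degStates_eq_sum_lab k u.1.state (by have := u.2; rwa [homDegree] at this)
    (fun s ↦ (if s.1.state = u.1.state then (-1 : ℚ) ^ K.pairCount u.1.state s.1.label u.1.label else 0) * x s)
    (fun s hs ↦ by rw [if_neg hs, zero_mul])]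
  refine Finset.sum_congr rfl fun mu _ ↦ ?_
  have hc : ((K.stateFibreLabEquiv k u.1.state (by have := u.2; rwa [homDegree] at this)).symm mu).1.1.state =
      u.1.state := rfl
  rw [if_pos hc]
  rfl

/-- **Lee's coordinates are multiplicative under the merge map.** For degree-zero cochains `x` of
`G`, `y` of `H` and Lee monomials `u₁ = (σ₁, ℓ₁)`, `u₂ = (σ₂, ℓ₂)` agreeing on the base arcs, the
pairing of `m(x, y)` with the glued monomial is `leeSign (ℓ₁ B) · ⟨x, u₁⟩ · ⟨y, u₂⟩`: in Lee's basis
`𝐚 = 𝟙 + X`, `𝐛 = -𝟙 + X` the multiplication of `A = ℚ[X]/(X² - 1)` is diagonal, `𝐚𝐚 = 2𝐚`,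
`𝐛𝐛 = -2𝐛`, `𝐚𝐛 = 0` (Lee (2005), §4; Rasmussen (2010), §2.4), which is the content of Rasmussen's
remark that the canonical generator of `K₁ # K₂` corresponds to `𝔰_a ⊗ 𝔰_b` (Prop. 3.11).
[cite: Rasmussen2010, Prop. 3.11] -/
theorem leeCoord_mergeMap_glue (x : G.degStates 0 → ℚ) (y : H.degStates 0 → ℚ) (u₁ : G.degStates 0)
    (u₂ : H.degStates 0) (hb : u₁.1.label G.baseArc = u₂.1.label H.baseArc) :
    (G.connSum H).leeCoord 0 (G.mergeMap H hG hH 0 1 0 0 0 x y) (glue₀ hG hH u₁ u₂ hb) =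
      leeSign (u₁.1.label G.baseArc) * G.leeCoord 0 x u₁ * H.leeCoord 0 y u₂ := by
  classical
  obtain ⟨⟨σ₁, ℓ₁, hℓ₁⟩, h0₁⟩ := u₁
  obtain ⟨⟨σ₂, ℓ₂, hℓ₂⟩, h0₂⟩ := u₂
  simp only at hb
  have hk₁ : (σ₁.weight : ℤ) - G.nMinus = 0 := by rwa [homDegree] at h0₁
  have hk₂ : (σ₂.weight : ℤ) - H.nMinus = 0 := by rwa [homDegree] at h0₂
  have he₁ : G.IsLabelOf σ₁ ℓ₁ := hℓ₁
  have he₂ : H.IsLabelOf σ₂ ℓ₂ := hℓ₂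
  have hkD : ((State.weight (G := G.connSum H) (Fin.append σ₁ σ₂) : ℕ) : ℤ) - (G.connSum H).nMinus = 0 := by
    have := (glue₀ hG hH ⟨⟨σ₁, ℓ₁, hℓ₁⟩, h0₁⟩ ⟨⟨σ₂, ℓ₂, hℓ₂⟩, h0₂⟩ hb).2
    rwa [homDegree] at this
  rw [leeCoord_apply_eq_sum_lab, leeCoord_apply_eq_sum_lab, leeCoord_apply_eq_sum_lab]
  change ∑ mu : KhFace.Lab ((G.connSum H).circleOf (Fin.append σ₁ σ₂)),
      (-1 : ℚ) ^ (G.connSum H).pairCount (Fin.append σ₁ σ₂) mu.1 (G.glueLab H hG hH ℓ₁ ℓ₂) *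
        G.mergeMap H hG hH 0 1 0 0 0 x y
          (((G.connSum H).stateFibreLabEquiv 0 (Fin.append σ₁ σ₂) hkD).symm mu).1 = _
  -- expand the merge map and restrict the two sums to the fibres of `σ₁`, `σ₂`
  have append_inj : ∀ {a a' : G.State} {b b' : H.State},
      (Fin.append a b : (G.connSum H).State) = Fin.append a' b' → a = a' ∧ b = b' := by
    intro a a' b b' h
    refine ⟨funext fun i ↦ ?_, funext fun j ↦ ?_⟩
    · have := congrFun h (Fin.castAdd H.n i)
      rwa [Fin.append_left, Fin.append_left] at this
    · have := congrFun h (Fin.natAdd G.n j)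
      rwa [Fin.append_right, Fin.append_right] at this
  have hexp : ∀ mu : KhFace.Lab ((G.connSum H).circleOf (Fin.append σ₁ σ₂)),
      G.mergeMap H hG hH 0 1 0 0 0 x y
        (((G.connSum H).stateFibreLabEquiv 0 (Fin.append σ₁ σ₂) hkD).symm mu).1 =
      ∑ la₁ : KhFace.Lab (G.circleOf σ₁), ∑ la₂ : KhFace.Lab (H.circleOf σ₂),
        x ((G.stateFibreLabEquiv 0 σ₁ hk₁).symm la₁).1 * y ((H.stateFibreLabEquiv 0 σ₂ hk₂).symm la₂).1 *
          KhFace.mergeInc ℚ 0 1 ((G.connSum H).circleOf (Fin.append σ₁ σ₂) ∘ G.arcEquiv H hG hH)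
            (Sum.elim la₁.1 la₂.1) (mu.1 ∘ G.arcEquiv H hG hH) (Sum.inl G.baseArc) (Sum.inr H.baseArc) := by
    intro mu
    rw [mergeMap_apply]
    rw [sum_degStates_eq_sum_lab 0 σ₁ hk₁ _ (fun s₁ hs₁ ↦ ?_)]
    · refine Finset.sum_congr rfl fun la₁ _ ↦ ?_
      rw [sum_degStates_eq_sum_lab 0 σ₂ hk₂ _ (fun s₂ hs₂ ↦ ?_)]
      · refine Finset.sum_congr rfl fun la₂ _ ↦ ?_
        congr 1
        exact if_pos rfl
      · rw [G.mergeEntry_of_ne H hG hH 0 1, mul_zero]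
        intro hst
        exact hs₂ (append_inj (show (Fin.append σ₁ σ₂ : (G.connSum H).State) = _ from hst)).2.symm
    · refine Finset.sum_eq_zero fun s₂ _ ↦ ?_
      rw [G.mergeEntry_of_ne H hG hH 0 1, mul_zero]
      intro hst
      exact hs₁ (append_inj (show (Fin.append σ₁ σ₂ : (G.connSum H).State) = _ from hst)).1.symm
  simp_rw [hexp]
  -- the inner sum over the labellings of `G # H`
  have hla : ∀ (la₁ : KhFace.Lab (G.circleOf σ₁)) (la₂ : KhFace.Lab (H.circleOf σ₂)),
      ∀ p q, Sum.map (G.circleOf σ₁) (H.circleOf σ₂) p = Sum.map (G.circleOf σ₁) (H.circleOf σ₂) q →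
        Sum.elim la₁.1 la₂.1 p = Sum.elim la₁.1 la₂.1 q := by
    rintro la₁ la₂ (p | p) (q | q) hpq
    · exact la₁.2 p q (by simpa using hpq)
    · simp at hpq
    · simp at hpq
    · exact la₂.2 p q (by simpa using hpq)
  have hinner : ∀ (la₁ : KhFace.Lab (G.circleOf σ₁)) (la₂ : KhFace.Lab (H.circleOf σ₂)),
      ∑ mu : KhFace.Lab ((G.connSum H).circleOf (Fin.append σ₁ σ₂)),
        (-1 : ℚ) ^ (G.connSum H).pairCount (Fin.append σ₁ σ₂) mu.1 (G.glueLab H hG hH ℓ₁ ℓ₂) *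
          KhFace.mergeInc ℚ 0 1 ((G.connSum H).circleOf (Fin.append σ₁ σ₂) ∘ G.arcEquiv H hG hH)
            (Sum.elim la₁.1 la₂.1) (mu.1 ∘ G.arcEquiv H hG hH) (Sum.inl G.baseArc) (Sum.inr H.baseArc) =
      (-1 : ℚ) ^ G.pairCount σ₁ la₁.1 ℓ₁ * (-1 : ℚ) ^ H.pairCount σ₂ la₂.1 ℓ₂ * leeSign (ℓ₁ G.baseArc) := by
    intro la₁ la₂
    -- reindex by labellings read on blocks
    rw [Fintype.sum_equiv (KhFace.labEquiv (G.arcEquiv H hG hH) ((G.connSum H).circleOf (Fin.append σ₁ σ₂))).symm _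
      (fun mu' : KhFace.Lab ((G.connSum H).circleOf (Fin.append σ₁ σ₂) ∘ G.arcEquiv H hG hH) ↦
        KhFace.mergeInc ℚ 0 1 ((G.connSum H).circleOf (Fin.append σ₁ σ₂) ∘ G.arcEquiv H hG hH)
            (Sum.elim la₁.1 la₂.1) mu'.1 (Sum.inl G.baseArc) (Sum.inr H.baseArc) *
          (-1 : ℚ) ^ (G.connSum H).pairCount (Fin.append σ₁ σ₂) (mu'.1 ∘ (G.arcEquiv H hG hH).symm)
            (G.glueLab H hG hH ℓ₁ ℓ₂))
      (fun mu ↦ by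
        change _ = KhFace.mergeInc ℚ 0 1 _ _ (mu.1 ∘ G.arcEquiv H hG hH) _ _ *
          (-1 : ℚ) ^ (G.connSum H).pairCount (Fin.append σ₁ σ₂)
            ((mu.1 ∘ G.arcEquiv H hG hH) ∘ (G.arcEquiv H hG hH).symm) (G.glueLab H hG hH ℓ₁ ℓ₂)
        rw [Function.comp_assoc, Equiv.self_comp_symm, Function.comp_id, mul_comm])]
    have hsum := KhFace.sum_mergeInc_mul (R := ℚ) (h := 0) (t := 1) (G.connSum_surg H σ₁ σ₂ hG hH)
      ⟨Sum.elim la₁.1 la₂.1, hla la₁ la₂⟩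
      (fun m ↦ (-1 : ℚ) ^ (G.connSum H).pairCount (Fin.append σ₁ σ₂) (m ∘ (G.arcEquiv H hG hH).symm)
        (G.glueLab H hG hH ℓ₁ ℓ₂))
    dsimp only at hsum
    rw [hsum]
    simp only [Sum.elim_inl, Sum.elim_inr]
    have hterm : ∀ v : Bool,
        (-1 : ℚ) ^ (G.connSum H).pairCount (Fin.append σ₁ σ₂)
          (KhFace.upd ((G.connSum H).circleOf (Fin.append σ₁ σ₂) ∘ G.arcEquiv H hG hH) (Sum.elim la₁.1 la₂.1)
              (Sum.inl G.baseArc) v ∘ (G.arcEquiv H hG hH).symm) (G.glueLab H hG hH ℓ₁ ℓ₂) =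
        (-1 : ℚ) ^ G.pairCount σ₁ la₁.1 ℓ₁ * (-1 : ℚ) ^ H.pairCount σ₂ la₂.1 ℓ₂ *
          pairSign v (ℓ₁ G.baseArc) * pairSign (la₁.1 G.baseArc) (ℓ₁ G.baseArc) *
          pairSign (la₂.1 H.baseArc) (ℓ₁ G.baseArc) := fun v ↦
      G.neg_one_pow_pairCount_mergedLab H hG hH (isLabelOf_of_lab la₁) he₁ (isLabelOf_of_lab la₂) he₂ hb v
    simp_rw [hterm]
    have htab := merge_table (la₁.1 G.baseArc) (la₂.1 H.baseArc) (ℓ₁ G.baseArc)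
    rw [Fintype.sum_bool] at htab ⊢
    linear_combination ((-1 : ℚ) ^ G.pairCount σ₁ la₁.1 ℓ₁ * (-1 : ℚ) ^ H.pairCount σ₂ la₂.1 ℓ₂) * htab
  -- reorder and factor
  calc _ = ∑ la₁ : KhFace.Lab (G.circleOf σ₁), ∑ la₂ : KhFace.Lab (H.circleOf σ₂),
        x ((G.stateFibreLabEquiv 0 σ₁ hk₁).symm la₁).1 * y ((H.stateFibreLabEquiv 0 σ₂ hk₂).symm la₂).1 *
        ∑ mu : KhFace.Lab ((G.connSum H).circleOf (Fin.append σ₁ σ₂)),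
          (-1 : ℚ) ^ (G.connSum H).pairCount (Fin.append σ₁ σ₂) mu.1 (G.glueLab H hG hH ℓ₁ ℓ₂) *
            KhFace.mergeInc ℚ 0 1 ((G.connSum H).circleOf (Fin.append σ₁ σ₂) ∘ G.arcEquiv H hG hH)
              (Sum.elim la₁.1 la₂.1) (mu.1 ∘ G.arcEquiv H hG hH) (Sum.inl G.baseArc) (Sum.inr H.baseArc) := by
          simp only [Finset.mul_sum]
          rw [Finset.sum_comm]
          refine Finset.sum_congr rfl fun la₁ _ ↦ ?_
          rw [Finset.sum_comm]
          refine Finset.sum_congr rfl fun la₂ _ ↦ Finset.sum_congr rfl fun mu _ ↦ by ring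
    _ = _ := by
          simp_rw [hinner]
          rw [mul_assoc, Finset.sum_mul_sum, Finset.mul_sum]
          refine Finset.sum_congr rfl fun la₁ _ ↦ ?_
          rw [Finset.mul_sum]
          refine Finset.sum_congr rfl fun la₂ _ ↦ ?_
          ring

end LeeCoord

/-! ## Lee theory supplements: the `X`-operator in Lee's coordinates, Lee's theorem under the dichotomy -/

section Lee

variable {G}

/-- Negating the first label multiplies the one-circle sign by `leeSign` of the second:
`s(¬x, t) = leeSign t · s(x, t)`. [folklore] -/
theorem pairSign_not (x t : Bool) : pairSign (!x) t = leeSign t * pairSign x t := by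
  cases x <;> cases t <;> norm_num [pairSign, leeSign]

/-- **Flipping a labelling on the circle of `α`** (the action of `X` at `α` on Lee's monomials and
on enhanced states alike). [folklore] -/
def flipLab (σ : G.State) (α : G.Arc) (mu : KhFace.Lab (G.circleOf σ)) : KhFace.Lab (G.circleOf σ) :=
  ⟨KhFace.upd (G.circleOf σ) mu.1 α (!mu.1 α), upd_congr mu.2⟩

/-- Flipping twice is the identity. [folklore] -/
theorem flipLab_flipLab (σ : G.State) (α : G.Arc) (mu : KhFace.Lab (G.circleOf σ)) :
    G.flipLab σ α (G.flipLab σ α mu) = mu := by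
  apply Subtype.ext
  funext x
  simp only [flipLab]
  unfold KhFace.upd
  by_cases hx : G.circleOf σ x = G.circleOf σ α
  · rw [if_pos hx, if_pos rfl, Bool.not_not]
    exact (mu.2 x α hx).symm
  · rw [if_neg hx, if_neg hx]

/-- Flipping the labelling on the circle of `α`, as a permutation of the labellings. [folklore] -/
def flipLabEquiv (σ : G.State) (α : G.Arc) : KhFace.Lab (G.circleOf σ) ≃ KhFace.Lab (G.circleOf σ) :=
  Function.Involutive.toPerm (G.flipLab σ α) (G.flipLab_flipLab σ α)

/-- **The action of `X` at `α` on an enhanced state flips its labelling on the circle of `α`.** [folklore] -/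
theorem actXDeg_stateFibreLabEquiv_symm (α : G.Arc) (k : ℤ) (τ : G.State) (hk : (τ.weight : ℤ) - G.nMinus = k)
    (mu : KhFace.Lab (G.circleOf τ)) :
    G.actXDeg α k ((G.stateFibreLabEquiv k τ hk).symm mu).1 =
      ((G.stateFibreLabEquiv k τ hk).symm (G.flipLab τ α mu)).1 := by
  apply Subtype.ext
  refine EnhancedState.ext' rfl ?_
  funext v
  change (if (G.stateGraph τ).Reachable α v then !mu.1 v else mu.1 v) =
    KhFace.upd (G.circleOf τ) mu.1 α (!mu.1 α) v
  unfold KhFace.upd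
  by_cases hv : G.circleOf τ v = G.circleOf τ α
  · rw [if_pos hv, if_pos (circleOf_eq_iff.1 hv.symm), mu.2 v α hv]
  · rw [if_neg hv, if_neg (fun h ↦ hv (circleOf_eq_iff.2 h).symm)]

/-- **Signs of a flipped labelling**: flipping `μ` on the circle of `α` multiplies
`(-1)^{pairCount σ μ ℓ}` by `leeSign (ℓ α)`. [folklore] -/
theorem neg_one_pow_pairCount_flipLab (σ : G.State) (α : G.Arc) (mu : KhFace.Lab (G.circleOf σ))
    {ell : G.Arc → Bool} (he : G.IsLabelOf σ ell) :
    (-1 : ℚ) ^ G.pairCount σ (G.flipLab σ α mu).1 ell =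
      leeSign (ell α) * (-1 : ℚ) ^ G.pairCount σ mu.1 ell := by
  classical
  have hl : G.IsLabelOf σ mu.1 := isLabelOf_of_lab mu
  have hl' : G.IsLabelOf σ (G.flipLab σ α mu).1 := isLabelOf_of_lab _
  rw [neg_one_pow_pairCount hl' he, neg_one_pow_pairCount hl he,
    ← Finset.mul_prod_erase _ _ (Finset.mem_univ (G.circleOf σ α)),
    ← Finset.mul_prod_erase _ (fun C ↦ if (!G.liftLabel σ mu.1 hl C && G.liftLabel σ ell he C) = true
      then (-1 : ℚ) else 1) (Finset.mem_univ (G.circleOf σ α))]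
  have hrest : ∏ C ∈ Finset.univ.erase (G.circleOf σ α),
      (if (!G.liftLabel σ (G.flipLab σ α mu).1 hl' C && G.liftLabel σ ell he C) = true then (-1 : ℚ) else 1) =
      ∏ C ∈ Finset.univ.erase (G.circleOf σ α),
        (if (!G.liftLabel σ mu.1 hl C && G.liftLabel σ ell he C) = true then (-1 : ℚ) else 1) := by
    refine Finset.prod_congr rfl fun C hC ↦ ?_
    rw [Finset.mem_erase] at hC
    induction C using SimpleGraph.ConnectedComponent.ind with | h a => ?_
    have ha : G.circleOf σ a ≠ G.circleOf σ α := hC.1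
    simp only [liftLabel_mk, flipLab, KhFace.upd_of_ne ha]
  rw [hrest, liftLabel_circleOf, liftLabel_circleOf, liftLabel_circleOf]
  simp only [flipLab, KhFace.upd_self]
  have := pairSign_not (mu.1 α) (ell α)
  simp only [pairSign] at this
  rw [this]
  ring

/-- **The `X`-operator is diagonal in Lee's coordinates**: the pairing of `X_α x` with a Lee
monomial `u = (σ, ℓ)` is `leeSign (ℓ α)` times that of `x` (`X 𝐚 = 𝐚`, `X 𝐛 = -𝐛` on the circle of
`α`). Lee (2005), §4; Rasmussen (2010), Lemma 3.5 (proof: the involution `ι`). [cite: Lee2005, §4] -/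
theorem leeCoord_leeX (α : G.Arc) (x : G.degStates 0 → ℚ) (u : G.degStates 0) :
    G.leeCoord 0 (G.leeX ℚ α 0 x) u = leeSign (u.1.label α) * G.leeCoord 0 x u := by
  have hk : (u.1.state.weight : ℤ) - G.nMinus = 0 := by have := u.2; rwa [homDegree] at this
  rw [leeCoord_apply_eq_sum_lab, leeCoord_apply_eq_sum_lab, Finset.mul_sum]
  simp only [leeX_apply]
  rw [← (G.flipLabEquiv u.1.state α).sum_comp]
  refine Finset.sum_congr rfl fun mu _ ↦ ?_
  change (-1 : ℚ) ^ G.pairCount u.1.state (G.flipLab u.1.state α mu).1 u.1.label *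
      x (G.actXDeg α 0 ((G.stateFibreLabEquiv 0 u.1.state hk).symm (G.flipLab u.1.state α mu)).1) = _
  rw [actXDeg_stateFibreLabEquiv_symm, flipLab_flipLab, neg_one_pow_pairCount_flipLab _ _ _ u.1.isLabelOf,
    mul_assoc]

/-- **Lee's theorem in degree zero under the merge/split dichotomy** (per diagram): if every flip
of `G` is a merge or a split, `dim_ℚ Kh'⁰(G) = 2`. The tree's
`finrank_leeHomologyZero_eq_two_of_dichotomy` (`LeeRasmussenRankProofs`) states this for realisable
diagrams under the global dichotomy fact; the proof is the same (chain contraction off the two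
canonical generators). Lee (2005), Thm. 4.2. [cite: Lee2005, Thm. 4.2] -/
theorem finrank_leeHomologyZero_eq_two_of_isMergeAt_or_isSplitAt
    (hms : ∀ (σ : G.State) (i : Fin G.n), σ i = false → G.IsMergeAt σ i ∨ G.IsSplitAt σ i) :
    Module.finrank ℚ G.LeeHomologyZero = 2 := by
  -- the maps, in the original coordinates
  set Ψm := G.leeCoord (0 - 1) with hΨm
  set Ψ₀ := G.leeCoord 0 with hΨ₀
  set Ψp := G.leeCoord (0 + 1) with hΨp
  set A := G.khovanovD ℚ 0 1 (0 - 1) 0 with hA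
  set B := G.khovanovD ℚ 0 1 0 (0 + 1) with hB
  set h₀ : (G.degStates 0 → ℚ) →ₗ[ℚ] (G.degStates (0 - 1) → ℚ) :=
    Ψm.symm.toLinearMap ∘ₗ Matrix.toLin' (G.leeHtpyMat 0 (0 - 1)) ∘ₗ Ψ₀.toLinearMap with hh₀
  set h₁ : (G.degStates (0 + 1) → ℚ) →ₗ[ℚ] (G.degStates 0 → ℚ) :=
    Ψ₀.symm.toLinearMap ∘ₗ Matrix.toLin' (G.leeHtpyMat (0 + 1) 0) ∘ₗ Ψp.toLinearMap with hh₁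
  set π : (G.degStates 0 → ℚ) →ₗ[ℚ] (G.degStates 0 → ℚ) :=
    Ψ₀.symm.toLinearMap ∘ₗ Matrix.toLin' (G.leeProjMat 0) ∘ₗ Ψ₀.toLinearMap with hπ
  have hBA : B ∘ₗ A = 0 :=
    khovanovD_comp_khovanovD_of_isMergeAt_or_isSplitAt G ℚ hms 0 1 (0 - 1)
  have hh : ∀ x, A (h₀ x) + h₁ (B x) = x - π x := by
    intro x
    simp only [hh₀, hh₁, hπ, hA, hB, LinearMap.coe_comp, Function.comp_apply,
      LinearEquiv.coe_coe]
    rw [khovanovD_leeCoord_symm, leeCoord_khovanovD, ← map_add, ← Matrix.toLin'_mul_apply,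
      ← Matrix.toLin'_mul_apply, ← LinearMap.add_apply, ← map_add,
      leeDiffMat_mul_leeHtpyMat_add hms 0, map_sub, Matrix.toLin'_one, LinearMap.sub_apply,
      LinearMap.id_apply, map_sub, LinearEquiv.symm_apply_apply]
  have hπA : ∀ y, π (A y) = 0 := by
    intro y
    simp only [hπ, hA, LinearMap.coe_comp, Function.comp_apply, LinearEquiv.coe_coe]
    rw [leeCoord_khovanovD, ← Matrix.toLin'_mul_apply, leeProjMat_mul_leeDiffMat, map_zero,
      LinearMap.zero_apply, map_zero]
  have hBπ : ∀ x, B (π x) = 0 := by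
    intro x
    simp only [hπ, hB, LinearMap.coe_comp, Function.comp_apply, LinearEquiv.coe_coe]
    rw [khovanovD_leeCoord_symm, ← Matrix.toLin'_mul_apply, leeDiffMat_mul_leeProjMat, map_zero,
      LinearMap.zero_apply, map_zero]
  have hππ : ∀ x, π (π x) = π x := by
    intro x
    simp only [hπ, LinearMap.coe_comp, Function.comp_apply, LinearEquiv.coe_coe]
    rw [LinearEquiv.apply_symm_apply, ← Matrix.toLin'_mul_apply, leeProjMat_mul_leeProjMat]
  have hrank : Module.finrank ℚ (LinearMap.range π) = 2 := by
    have hr : LinearMap.range π =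
        (LinearMap.range (Matrix.toLin' (G.leeProjMat 0))).map Ψ₀.symm.toLinearMap := by
      rw [hπ, LinearMap.range_comp, LinearMap.range_comp, LinearEquiv.range, Submodule.map_top]
    rw [hr, LinearEquiv.finrank_map_eq]
    exact finrank_range_leeProjMat_zero hms
  change Module.finrank ℚ (↥(LinearMap.ker B) ⧸ (LinearMap.range A).comap (LinearMap.ker B).subtype) = 2
  rw [finrank_ker_quotient_eq_of_homotopy A B h₀ h₁ π hBA hh hπA hBπ hππ, hrank]

/-- **Lee's spanning theorem under the dichotomy** (per diagram): a degree-zero cycle whose Lee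
coordinates vanish at the two canonical states is a boundary. The tree's
`mem_range_of_leeCoord_apply_eq_zero` (`RasmussenSliceCanonicalProofs`) assumes realisability and
uses it only through the dichotomy; same proof. Lee (2005), Thm. 4.2. [cite: Lee2005, Thm. 4.2] -/
theorem mem_range_of_leeCoord_apply_eq_zero_of_isMergeAt_or_isSplitAt
    (hms : ∀ (σ : G.State) (i : Fin G.n), σ i = false → G.IsMergeAt σ i ∨ G.IsSplitAt σ i)
    {z : G.degStates 0 → ℚ} (hz : z ∈ G.leeCycles)
    (h0 : ∀ s : G.degStates 0, (∀ i, ¬ G.Free s.1.label i) → G.leeCoord 0 z s = 0) :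
    z ∈ LinearMap.range (G.khovanovD ℚ 0 1 (0 - 1) 0) := by
  have hId := leeDiffMat_mul_leeHtpyMat_add hms 0
  set v := G.leeCoord 0 z with hv
  have hDv : Matrix.toLin' (G.leeDiffMat 0 (0 + 1)) v = 0 := by
    have h1 := leeCoord_khovanovD 0 (0 + 1) z
    rw [LinearMap.mem_ker.1 hz, map_zero] at h1
    exact h1.symm
  have hPv : Matrix.toLin' (G.leeProjMat 0) v = 0 := by
    ext s
    rw [Matrix.toLin'_apply, leeProjMat, Matrix.mulVec_diagonal, Pi.zero_apply]
    by_cases hs : ∀ i, ¬ G.Free s.1.label i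
    · rw [if_pos hs, one_mul]
      exact h0 s hs
    · rw [if_neg hs, zero_mul]
  have hvsum : Matrix.toLin' (G.leeDiffMat (0 - 1) 0)
      (Matrix.toLin' (G.leeHtpyMat 0 (0 - 1)) v) = v := by
    have h1 := congrArg (fun M ↦ Matrix.toLin' M v) hId
    simp only [map_add, map_sub, LinearMap.add_apply, LinearMap.sub_apply,
      Matrix.toLin'_mul_apply, Matrix.toLin'_one, LinearMap.id_apply, hDv, map_zero, hPv,
      add_zero, sub_zero] at h1
    exact h1
  refine ⟨(G.leeCoord (0 - 1)).symm (Matrix.toLin' (G.leeHtpyMat 0 (0 - 1)) v), ?_⟩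
  rw [khovanovD_leeCoord_symm, hvsum, hv, LinearEquiv.symm_apply_apply]

/-- **Every cycle is its canonical part plus a boundary, under the dichotomy** (per diagram).
Lee (2005), Thm. 4.2; Rasmussen (2010), §2.4. [cite: Lee2005, Thm. 4.2] -/
theorem sub_sum_canonical_mem_range_of_isMergeAt_or_isSplitAt
    (hms : ∀ (σ : G.State) (i : Fin G.n), σ i = false → G.IsMergeAt σ i ∨ G.IsSplitAt σ i)
    {z : G.degStates 0 → ℚ} (hz : z ∈ G.leeCycles) :
    z - ∑ s : {s : G.degStates 0 // ∀ i, ¬ G.Free s.1.label i},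
        G.leeCoord 0 z s.1 • (G.leeCoord 0).symm (Pi.single s.1 1) ∈
      LinearMap.range (G.khovanovD ℚ 0 1 (0 - 1) 0) := by
  refine mem_range_of_leeCoord_apply_eq_zero_of_isMergeAt_or_isSplitAt hms
    (Submodule.sub_mem _ hz (Submodule.sum_mem _ fun s _ ↦
      Submodule.smul_mem _ _ (leeCoord_symm_single_mem_leeCycles s.2))) fun u hu ↦ ?_
  rw [map_sub, map_sum, Pi.sub_apply, Finset.sum_apply,
    Finset.sum_eq_single (⟨u, hu⟩ : {s : G.degStates 0 // ∀ i, ¬ G.Free s.1.label i})]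
  · rw [map_smul, LinearEquiv.apply_symm_apply, Pi.smul_apply, Pi.single_eq_same, smul_eq_mul,
      mul_one, sub_self]
  · intro s _ hs
    have hne : u ≠ s.1 := fun h ↦ hs (Subtype.ext h.symm)
    rw [map_smul, LinearEquiv.apply_symm_apply, Pi.smul_apply, Pi.single_eq_of_ne hne,
      smul_zero]
  · intro h
    exact absurd (Finset.mem_univ _) h

/-- **A cycle is a boundary iff its Lee coordinates vanish at the canonical states** (under the
dichotomy). Lee (2005), Thm. 4.2. [cite: Lee2005, Thm. 4.2] -/
theorem mem_range_iff_leeCoord_apply_eq_zero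
    (hms : ∀ (σ : G.State) (i : Fin G.n), σ i = false → G.IsMergeAt σ i ∨ G.IsSplitAt σ i)
    {z : G.degStates 0 → ℚ} (hz : z ∈ G.leeCycles) :
    z ∈ LinearMap.range (G.khovanovD ℚ 0 1 (0 - 1) 0) ↔
      ∀ s : G.degStates 0, (∀ i, ¬ G.Free s.1.label i) → G.leeCoord 0 z s = 0 :=
  ⟨fun h _ hs ↦ leeCoord_apply_eq_zero_of_mem_range h hs,
    mem_range_of_leeCoord_apply_eq_zero_of_isMergeAt_or_isSplitAt hms hz⟩

/-- **The two canonical states** (Gauss parity): the degree-zero enhanced states with no free chord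
are Lee's states `leeState t`, `t : Bool` (the equivalence behind `card_noFree_degStates_zero`).
Lee (2005), §4.4.3; Rasmussen (2010), §2.4. [cite: Rasmussen2010, §2.4] -/
def noFreeEquivBool (hpar : ∀ i, (G.overPos i).val % 2 ≠ (G.underPos i).val % 2) :
    {s : G.degStates 0 // ∀ i, ¬ G.Free s.1.label i} ≃ Bool where
  toFun s := s.1.1.label G.arcZero
  invFun t := ⟨⟨G.leeState hpar t, homDegree_leeState hpar t⟩, (isAlternating_altLabel t).not_free⟩
  left_inv := by
    rintro ⟨⟨s, hs⟩, hf⟩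
    have ha : G.IsAlternating s.label := isAlternating_of_forall_not_free s.isLabelOf hf
    apply Subtype.ext; apply Subtype.ext
    refine EnhancedState.ext' ?_ ?_
    · exact (eq_seifertState_of_forall fun i ↦ isSeifert_of_isAlternating s.isLabelOf ha (hpar i)).symm
    · exact (isAlternating_altLabel _).eq_of_apply_arcZero_eq ha (altLabel_arcZero _)
  right_inv := fun t ↦ altLabel_arcZero (G := G) t

/-- Lee's canonical state `t`, as a degree-zero enhanced state. [cite: Rasmussen2010, §2.4] -/
abbrev leeState₀ (hpar : ∀ i, (G.overPos i).val % 2 ≠ (G.underPos i).val % 2) (t : Bool) : G.degStates 0 :=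
  ⟨G.leeState hpar t, homDegree_leeState hpar t⟩

/-- Lee's canonical states have no free chord. [cite: Rasmussen2010, §2.4] -/
theorem not_free_leeState (hpar : ∀ i, (G.overPos i).val % 2 ≠ (G.underPos i).val % 2) (t : Bool)
    (i : Fin G.n) : ¬ G.Free (G.leeState hpar t).label i :=
  (isAlternating_altLabel t).not_free i

/-- **Sums over the canonical states** are sums over `t : Bool`. [folklore] -/
theorem sum_noFree_eq (hpar : ∀ i, (G.overPos i).val % 2 ≠ (G.underPos i).val % 2) {M : Type*}
    [AddCommMonoid M] (f : {s : G.degStates 0 // ∀ i, ¬ G.Free s.1.label i} → M) :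
    ∑ s, f s = f ⟨G.leeState₀ hpar false, G.not_free_leeState hpar false⟩ +
      f ⟨G.leeState₀ hpar true, G.not_free_leeState hpar true⟩ := by
  rw [← (G.noFreeEquivBool hpar).symm.sum_comp, Fintype.sum_bool, add_comm]
  rfl

/-- **A cycle is a boundary iff its two canonical Lee coordinates vanish** (Gauss parity).
Lee (2005), Thm. 4.2. [cite: Lee2005, Thm. 4.2] -/
theorem mem_range_iff_leeCoord_leeState_eq_zero
    (hpar : ∀ i, (G.overPos i).val % 2 ≠ (G.underPos i).val % 2)
    {z : G.degStates 0 → ℚ} (hz : z ∈ G.leeCycles) :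
    z ∈ LinearMap.range (G.khovanovD ℚ 0 1 (0 - 1) 0) ↔
      ∀ t : Bool, G.leeCoord 0 z (G.leeState₀ hpar t) = 0 := by
  rw [mem_range_iff_leeCoord_apply_eq_zero (fun _ _ h ↦ isMergeAt_or_isSplitAt_of_overPos_mod_two_ne hpar h) hz]
  constructor
  · exact fun h t ↦ h _ (G.not_free_leeState hpar t)
  · intro h s hs
    obtain ⟨t, ht⟩ := (G.noFreeEquivBool hpar).symm.surjective ⟨s, hs⟩
    have : s = G.leeState₀ hpar t := by
      have := congrArg Subtype.val ht
      exact this.symm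
    rw [this]
    exact h t

/-- **The canonical generators are eigenvectors of the `X`-operator** (at the chain level):
`X_α ŝ_t = leeSign (ℓ_t α) · ŝ_t` for the canonical generator `ŝ_t = (leeCoord 0)⁻¹ e_t`
(`X 𝐚 = 𝐚`, `X 𝐛 = -𝐛`). Rasmussen (2010), proof of Lemma 3.5. [cite: Rasmussen2010, Lemma 3.5] -/
theorem leeX_leeCoord_symm_single (α : G.Arc) (s : G.degStates 0) :
    G.leeX ℚ α 0 ((G.leeCoord 0).symm (Pi.single s 1)) =
      leeSign (s.1.label α) • (G.leeCoord 0).symm (Pi.single s 1) := by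
  apply (G.leeCoord 0).injective
  rw [map_smul, LinearEquiv.apply_symm_apply]
  funext u
  rw [leeCoord_leeX, LinearEquiv.apply_symm_apply, Pi.smul_apply, smul_eq_mul]
  by_cases hu : u = s
  · subst hu
    rfl
  · rw [Pi.single_eq_of_ne hu, mul_zero, mul_zero]

/-! ### Classes of top filtration degree -/

/-- **`s_max` is attained by a nonzero class** (the filtration degrees of nonzero classes are
integers from the finite set of quantum degrees of degree-zero states). Rasmussen (2010), Def. 3.1.
[cite: Rasmussen2010, Def. 3.1] -/
theorem exists_classDegree_eq_leeSMax (h : ∃ a : G.LeeH0, a ≠ 0) :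
    ∃ a : G.LeeH0, a ≠ 0 ∧ ∃ n : ℤ, classDegree a = ((n : WithTop ℤ) : WithBot (WithTop ℤ)) ∧
      G.leeSMax = ((n : WithTop ℤ) : WithBot (WithTop ℤ)) := by
  classical
  set Q : Finset ℤ := Finset.univ.image fun s : G.degStates 0 ↦ qDegree s.1 with hQ
  -- the degree of a nonzero class is the quantum degree of a state
  have hdeg : ∀ a : G.LeeH0, a ≠ 0 → ∃ n ∈ Q, classDegree a = ((n : WithTop ℤ) : WithBot (WithTop ℤ)) := by
    intro a ha
    obtain ⟨n, hn, ⟨z, hz, hle⟩, hge⟩ := exists_classDegree_eq_coe ha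
    obtain ⟨s, -, hs⟩ := exists_qMin_eq_coe (ne_zero_of_mk_eq hz ha)
    have h1 : qMin z.1 = ((n : WithTop ℤ) : WithBot (WithTop ℤ)) := le_antisymm (hge z hz) hle
    refine ⟨n, ?_, hn⟩
    rw [hs] at h1
    have : qDegree s.1 = n := by
      have := WithBot.coe_injective h1
      exact_mod_cast this
    exact Finset.mem_image.2 ⟨s, Finset.mem_univ _, this⟩
  set T : Finset ℤ := Q.filter fun n ↦ ∃ a : G.LeeH0, a ≠ 0 ∧
    classDegree a = ((n : WithTop ℤ) : WithBot (WithTop ℤ)) with hT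
  have hTne : T.Nonempty := by
    obtain ⟨a, ha⟩ := h
    obtain ⟨n, hn, hna⟩ := hdeg a ha
    exact ⟨n, Finset.mem_filter.2 ⟨hn, a, ha, hna⟩⟩
  obtain ⟨a, ha, hna⟩ := (Finset.mem_filter.1 (T.max'_mem hTne)).2
  refine ⟨a, ha, T.max' hTne, hna, le_antisymm ?_ (le_iSup₂_of_le a ha hna.ge)⟩
  refine iSup₂_le fun b hb ↦ ?_
  obtain ⟨m, hm, hmb⟩ := hdeg b hb
  rw [hmb]
  exact_mod_cast T.le_max' m (Finset.mem_filter.2 ⟨hm, b, hb, hmb⟩)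

/-- The splitting of `Kh'⁰` into two of its `q mod 4` summands (when it is two-dimensional):
`a = P_{ρ₀} a + P_{ρ₀+2} a`. Rasmussen (2010), Lemma 3.5, Cor. 3.7. [cite: Rasmussen2010, Cor. 3.7] -/
theorem eq_qProjBar_add_qProjBar {ρ₀ : ZMod 4} (hP₁ : G.qProjBar (ρ₀ + 1) = 0) (hP₃ : G.qProjBar (ρ₀ + 3) = 0)
    (a : G.LeeH0) : a = G.qProjBar ρ₀ a + G.qProjBar (ρ₀ + 2) a := by
  have hne : (ρ₀ : ZMod 4) ≠ ρ₀ + 2 := by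
    intro h
    have h' : (2 : ZMod 4) = 0 := by
      have := congrArg (fun x ↦ x - ρ₀) h
      simpa using this.symm
    exact absurd h' (by decide)
  have hs := sum_qProjBar a
  rw [Finset.sum_eq_add ρ₀ (ρ₀ + 2) hne ?_ (fun h ↦ (h (Finset.mem_univ _)).elim)
    (fun h ↦ (h (Finset.mem_univ _)).elim)] at hs
  · exact hs.symm
  · rintro ρ - ⟨h₁, h₂⟩
    rcases zmod_four_eq_add_cases ρ₀ ρ with rfl | rfl | rfl | rfl
    · exact (h₁ rfl).elim
    · rw [hP₁, LinearMap.zero_apply]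
    · exact (h₂ rfl).elim
    · rw [hP₃, LinearMap.zero_apply]

/-- **A homogeneous class of top filtration degree.** If `dim Kh'⁰ = 2`, some nonzero class in one
of the `q mod 4` summands has filtration degree `s_max` (take a class attaining `s_max`; if both its
homogeneous components are nonzero, its degree is the minimum of theirs, so a component attains
`s_max` too). Rasmussen (2010), Lemma 3.5, Cor. 3.6. [cite: Rasmussen2010, Cor. 3.6] -/
theorem exists_qProjBar_eq_classDegree_eq_leeSMax (h2 : Module.finrank ℚ G.LeeHomologyZero = 2)
    (α : G.Arc) :
    ∃ (a : G.LeeH0) (ρ : ZMod 4) (n : ℤ), a ≠ 0 ∧ G.qProjBar ρ a = a ∧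
      classDegree a = ((n : WithTop ℤ) : WithBot (WithTop ℤ)) ∧
      G.leeSMax = ((n : WithTop ℤ) : WithBot (WithTop ℤ)) := by
  have h2' : Module.finrank ℚ G.LeeH0 = 2 := h2
  have hex : ∃ a : G.LeeH0, a ≠ 0 := by
    rw [← Module.finrank_pos_iff_exists_ne_zero (R := ℚ), h2']
    exact Nat.succ_pos 1
  obtain ⟨a, ha, n, hn, hmax⟩ := exists_classDegree_eq_leeSMax hex
  obtain ⟨ρ₀, hρ₀, hρ₂, hP₁, hP₃⟩ := exists_finrank_range_qProjBar α h2'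
  have hdec := eq_qProjBar_add_qProjBar hP₁ hP₃ a
  by_cases h₀ : G.qProjBar ρ₀ a = 0
  · refine ⟨a, ρ₀ + 2, n, ha, ?_, hn, hmax⟩
    rw [hdec, h₀, zero_add, qProjBar_qProjBar]
  by_cases h₂ : G.qProjBar (ρ₀ + 2) a = 0
  · refine ⟨a, ρ₀, n, ha, ?_, hn, hmax⟩
    rw [hdec, h₂, add_zero, qProjBar_qProjBar]
  -- both components nonzero: the degree of `a` is the minimum, so a component attains `s_max`
  obtain ⟨n₁, hn₁, -, -⟩ := exists_classDegree_eq_coe h₀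
  obtain ⟨n₂, hn₂, -, -⟩ := exists_classDegree_eq_coe h₂
  have hne : (ρ₀ : ZMod 4) ≠ ρ₀ + 2 := by
    intro h
    have h' : (2 : ZMod 4) = 0 := by
      have := congrArg (fun x ↦ x - ρ₀) h
      simpa using this.symm
    exact absurd h' (by decide)
  have hmin := classDegree_add_eq_min hne h₀ h₂ (qProjBar_qProjBar ρ₀ a) (qProjBar_qProjBar (ρ₀ + 2) a) hn₁ hn₂
  rw [← hdec, hn] at hmin
  have hnm : n = min n₁ n₂ := by
    have := WithBot.coe_injective hmin
    exact_mod_cast this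
  have hle₁ : ((n₁ : WithTop ℤ) : WithBot (WithTop ℤ)) ≤ G.leeSMax := le_iSup₂_of_le _ h₀ hn₁.ge
  rw [hmax] at hle₁
  have hle₁' : n₁ ≤ n := by
    rw [WithBot.coe_le_coe, WithTop.coe_le_coe] at hle₁
    exact hle₁
  have heq : n₁ = n := le_antisymm hle₁' (hnm ▸ min_le_left n₁ n₂)
  refine ⟨G.qProjBar ρ₀ a, ρ₀, n, h₀, qProjBar_qProjBar ρ₀ a, ?_, hmax⟩
  rw [hn₁, heq]

/-- **A nonzero homogeneous class has both canonical coordinates nonzero.** If a nonzero class of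
`Kh'⁰` lies in one `q mod 4` summand, the Lee coordinates of its representatives do not vanish at
either canonical state: otherwise the class would be a multiple of one canonical class, which would
then be homogeneous and an eigenvector of the `X`-operator — but `X` maps each summand to the other,
so the canonical class would vanish, contradicting the independence of the canonical generators.
Rasmussen (2010), Lemma 3.5 (`𝔰_o ± 𝔰_ō` are homogeneous, `𝔰_o`, `𝔰_ō` are not), Cor. 3.6.
[cite: Rasmussen2010, Lemma 3.5] -/
theorem leeCoord_leeState_ne_zero_of_qProjBar_eq (hpar : ∀ i, (G.overPos i).val % 2 ≠ (G.underPos i).val % 2)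
    (α : G.Arc) {ρ : ZMod 4} {z : G.leeCycles} (hz0 : (Submodule.Quotient.mk z : G.LeeH0) ≠ 0)
    (hρ : G.qProjBar ρ (Submodule.Quotient.mk z) = Submodule.Quotient.mk z) (t : Bool) :
    G.leeCoord 0 z.1 (G.leeState₀ hpar t) ≠ 0 := by
  have hms : ∀ (σ : G.State) (i : Fin G.n), σ i = false → G.IsMergeAt σ i ∨ G.IsSplitAt σ i :=
    fun _ _ h ↦ isMergeAt_or_isSplitAt_of_overPos_mod_two_ne hpar h
  intro ht
  -- `z` is a multiple of the other canonical generator modulo boundaries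
  set c : ℚ := G.leeCoord 0 z.1 (G.leeState₀ hpar (!t)) with hc
  set shat : G.leeCycles := ⟨(G.leeCoord 0).symm (Pi.single (G.leeState₀ hpar (!t)) 1),
    leeCoord_symm_single_mem_leeCycles (G.not_free_leeState hpar (!t))⟩ with hshat
  have hrange := sub_sum_canonical_mem_range_of_isMergeAt_or_isSplitAt hms z.2
  rw [sum_noFree_eq hpar] at hrange
  have hzc : (Submodule.Quotient.mk z : G.LeeH0) = c • Submodule.Quotient.mk shat := by
    rw [← Submodule.Quotient.mk_smul, eq_comm, ← sub_eq_zero, ← Submodule.Quotient.mk_sub,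
      Submodule.Quotient.mk_eq_zero]
    change (c • shat - z).1 ∈ LinearMap.range (G.khovanovD ℚ 0 1 (0 - 1) 0)
    have hneg : (c • shat - z).1 = -(z.1 - (G.leeCoord 0 z.1 (G.leeState₀ hpar false) •
        (G.leeCoord 0).symm (Pi.single (G.leeState₀ hpar false) 1) +
        G.leeCoord 0 z.1 (G.leeState₀ hpar true) •
        (G.leeCoord 0).symm (Pi.single (G.leeState₀ hpar true) 1))) := by
      cases t
      · simp only [Bool.not_false] at hc hshat
        rw [ht, zero_smul, zero_add, hshat, hc]
        simp
      · simp only [Bool.not_true] at hc hshat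
        rw [ht, zero_smul, add_zero, hshat, hc]
        simp
    rw [hneg]
    exact Submodule.neg_mem _ hrange
  have hc0 : c ≠ 0 := by
    intro h0
    rw [h0, zero_smul] at hzc
    exact hz0 hzc
  -- hence the canonical class is homogeneous …
  have hfix : G.qProjBar ρ (Submodule.Quotient.mk shat) = Submodule.Quotient.mk shat := by
    have := congrArg (fun a ↦ c⁻¹ • a) hρ
    simp only [hzc, map_smul, smul_smul, inv_mul_cancel₀ hc0, one_smul] at this
    exact this
  -- … and an eigenvector of `X`, which exchanges the summands `ρ` and `ρ + 2`
  have hX : G.leeXBar α (Submodule.Quotient.mk shat) =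
      leeSign ((G.leeState hpar (!t)).label α) • Submodule.Quotient.mk shat := by
    rw [leeXBar_mk, ← Submodule.Quotient.mk_smul]
    congr 1
    apply Subtype.ext
    simp only [hshat, Submodule.coe_smul]
    exact leeX_leeCoord_symm_single α (G.leeState₀ hpar (!t))
  have hmem : G.leeXBar α (Submodule.Quotient.mk shat) ∈ LinearMap.range (G.qProjBar (ρ + 2)) :=
    leeXBar_mem_range α ρ ⟨_, hfix⟩
  rw [hX] at hmem
  obtain ⟨w, hw⟩ := hmem
  have hshat2 : Submodule.Quotient.mk shat = G.qProjBar (ρ + 2) ((leeSign ((G.leeState hpar (!t)).label α))⁻¹ • w) := by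
    rw [map_smul, hw, smul_smul, inv_mul_cancel₀ (leeSign_ne_zero _), one_smul]
  have hzero : (Submodule.Quotient.mk shat : G.LeeH0) = 0 := by
    have hne : ρ ≠ ρ + 2 := by
      intro h
      have h' : (2 : ZMod 4) = 0 := by
        have := congrArg (fun x ↦ x - ρ) h
        simpa using this.symm
      exact absurd h' (by decide)
    rw [← hfix, hshat2, qProjBar_qProjBar_of_ne hne]
  -- contradiction with the independence of the canonical generators
  rw [Submodule.Quotient.mk_eq_zero] at hzero
  change shat.1 ∈ LinearMap.range (G.khovanovD ℚ 0 1 (0 - 1) 0) at hzero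
  have h1 := leeCoord_apply_eq_zero_of_mem_range hzero (s := G.leeState₀ hpar (!t)) (G.not_free_leeState hpar (!t))
  rw [hshat] at h1
  simp only [LinearEquiv.apply_symm_apply, Pi.single_eq_same] at h1
  exact one_ne_zero h1

end Lee

/-! ## Additivity of Rasmussen's `s` for diagrams -/

section Additivity

variable {G}

/-- `d² = 0` with reindexed degrees (cf. the private lemma of `LeeRasmussenMirrorProofs`).
[cite: Khovanov2000, Prop. 8] -/
theorem khovanovD_comp_eq_zero_of_eq {K : GaussDiagram} {i j k : ℤ} (hj : i + 1 = j) (hk : i + 1 + 1 = k)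
    (h : K.khovanovD ℚ 0 1 (i + 1) (i + 1 + 1) ∘ₗ K.khovanovD ℚ 0 1 i (i + 1) = 0) :
    K.khovanovD ℚ 0 1 j k ∘ₗ K.khovanovD ℚ 0 1 i j = 0 := by
  subst hj hk
  exact h

/-- Gauss parity is invariant under mirror image (the positions of the two ends of each chord are
exchanged). [folklore] -/
theorem parity_mirror {K : GaussDiagram} (hp : ∀ i, (K.overPos i).val % 2 ≠ (K.underPos i).val % 2) :
    ∀ i, (K.mirror.overPos i).val % 2 ≠ (K.mirror.underPos i).val % 2 :=
  fun i ↦ (hp i).symm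

/-- **`s(Ḡ) = -s(G)` for every Gauss diagram with Gauss parity** (per diagram; the tree's discharge
`rasmussenInvariant_mirror_holds` is stated for realisable diagrams): `d² = 0` and `dim Kh'⁰ = 2`
follow from the merge/split dichotomy, `s_max = s_min + 2` from the dimension, and the duality is
`rasmussenInvariant_mirror_of_le`. Rasmussen (2010), Prop. 3.9. [cite: Rasmussen2010, Prop. 3.9] -/
theorem rasmussenInvariant_mirror_of_parity_self {K : GaussDiagram}
    (hp : ∀ i, (K.overPos i).val % 2 ≠ (K.underPos i).val % 2) :
    K.mirror.rasmussenInvariant = -K.rasmussenInvariant := by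
  have hms : ∀ (σ : K.State) (i : Fin K.n), σ i = false → K.IsMergeAt σ i ∨ K.IsSplitAt σ i :=
    fun _ _ h ↦ isMergeAt_or_isSplitAt_of_overPos_mod_two_ne hp h
  refine rasmussenInvariant_mirror_of_le (LinearMap.range_le_ker_iff.mpr ?_)
    (leeSMax_eq_leeSMin_add_two_of_finrank_eq_two
      (finrank_leeHomologyZero_eq_two_of_isMergeAt_or_isSplitAt hms))
  exact khovanovD_comp_eq_zero_of_eq (by norm_num) (by norm_num)
    (khovanovD_comp_khovanovD_of_isMergeAt_or_isSplitAt K ℚ hms 0 1 (0 - 1))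

/-- Rasmussen's `s` of a diagram from an integer value of `s_max`: `s = s_max - 1`. [cite: Rasmussen2010, Def. 3.4] -/
theorem rasmussenInvariant_eq_of_leeSMax_eq {K : GaussDiagram} {n : ℤ}
    (h : K.leeSMax = ((n : WithTop ℤ) : WithBot (WithTop ℤ))) : K.rasmussenInvariant = n - 1 := by
  unfold rasmussenInvariant
  rw [h]
  rfl

variable (G)

/-- **Lee's canonical states of `G # H` in degree zero are glued from those of the blocks.**
[cite: Rasmussen2010, Prop. 3.11] -/
theorem leeState₀_connSum (hpG : ∀ i, (G.overPos i).val % 2 ≠ (G.underPos i).val % 2)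
    (hpH : ∀ j, (H.overPos j).val % 2 ≠ (H.underPos j).val % 2)
    (hpD : ∀ k, ((G.connSum H).overPos k).val % 2 ≠ ((G.connSum H).underPos k).val % 2) (t : Bool) :
    (G.connSum H).leeState₀ hpD t =
      glue₀ hG hH (G.leeState₀ hpG t) (H.leeState₀ hpH t) (G.leeState_label_baseArc H hG hH hpG hpH t) :=
  Subtype.ext (G.glue_leeState H hG hH hpG hpH hpD t (G.leeState_label_baseArc H hG hH hpG hpH t)).symm

include hG hH in
/-- **Lower bound: `s(G # H) ≥ s(G) + s(H)`** for Gauss diagrams with Gauss parity (at least one chord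
each). Take homogeneous classes of top filtration degree of `G` and of `H` with optimal
representatives `z₁`, `z₂`; the merged cycle `m(z₁, z₂)` has filtration degree
`≥ s_max(G) + s_max(H) - 1` (`le_qMin_mergeMap`) and is not a boundary, its Lee coordinate at a
canonical state of `G # H` being `± ⟨z₁, 𝔰⟩ ⟨z₂, 𝔰⟩ ≠ 0` (`leeCoord_mergeMap_glue`,
`leeCoord_leeState_ne_zero_of_qProjBar_eq`); hence `s_max(G # H) ≥ s_max(G) + s_max(H) - 1`. This is
Rasmussen's inequality `s(𝔰_o) - 1 ≤ s(𝔰_a ⊗ 𝔰_b)` of the proof of Prop. 3.11, read for the saddle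
map in the direction `D₁ ⊔ D₂ → D₁ # D₂`. [cite: Rasmussen2010, Prop. 3.11] -/
theorem add_le_rasmussenInvariant_connSum (hpG : ∀ i, (G.overPos i).val % 2 ≠ (G.underPos i).val % 2)
    (hpH : ∀ j, (H.overPos j).val % 2 ≠ (H.underPos j).val % 2) :
    G.rasmussenInvariant + H.rasmussenInvariant ≤ (G.connSum H).rasmussenInvariant := by
  have hpD := G.connSum_parity H hpG hpH
  have hmsG : ∀ (σ : G.State) (i : Fin G.n), σ i = false → G.IsMergeAt σ i ∨ G.IsSplitAt σ i :=
    fun _ _ h ↦ isMergeAt_or_isSplitAt_of_overPos_mod_two_ne hpG h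
  have hmsH : ∀ (σ : H.State) (i : Fin H.n), σ i = false → H.IsMergeAt σ i ∨ H.IsSplitAt σ i :=
    fun _ _ h ↦ isMergeAt_or_isSplitAt_of_overPos_mod_two_ne hpH h
  have hmsD : ∀ (σ : (G.connSum H).State) (k : Fin (G.connSum H).n), σ k = false →
      (G.connSum H).IsMergeAt σ k ∨ (G.connSum H).IsSplitAt σ k :=
    fun _ _ h ↦ isMergeAt_or_isSplitAt_of_overPos_mod_two_ne hpD h
  have h2G := finrank_leeHomologyZero_eq_two_of_isMergeAt_or_isSplitAt hmsG
  have h2H := finrank_leeHomologyZero_eq_two_of_isMergeAt_or_isSplitAt hmsH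
  -- homogeneous top classes and optimal representatives
  obtain ⟨a₁, ρ₁, n₁, ha₁, hρ₁, hn₁, hmax₁⟩ := exists_qProjBar_eq_classDegree_eq_leeSMax h2G G.arcZero
  obtain ⟨a₂, ρ₂, n₂, ha₂, hρ₂, hn₂, hmax₂⟩ := exists_qProjBar_eq_classDegree_eq_leeSMax h2H H.arcZero
  obtain ⟨m₁, hm₁, ⟨z₁, hz₁, hle₁⟩, -⟩ := exists_classDegree_eq_coe ha₁
  obtain ⟨m₂, hm₂, ⟨z₂, hz₂, hle₂⟩, -⟩ := exists_classDegree_eq_coe ha₂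
  obtain rfl := classDegree_coe_injective hn₁ hm₁
  obtain rfl := classDegree_coe_injective hn₂ hm₂
  -- the merged cycle
  set μ := G.mergeMap H hG hH 0 1 0 0 0 z₁.1 z₂.1 with hμdef
  have hμ : μ ∈ (G.connSum H).leeCycles :=
    G.mergeMap_mem_ker H hG hH 0 1 hmsG hmsH (i := 0) (j := 0) (k := 0) (by norm_num) (0 + 1) z₁.2 z₂.2
  have hq : (((n₁ + n₂ - 1 : ℤ) : WithTop ℤ) : WithBot (WithTop ℤ)) ≤ qMin μ :=
    G.le_qMin_mergeMap H hG hH 1 z₁.1 z₂.1 hle₁ hle₂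
  -- it is not a boundary: its Lee coordinate at a canonical state is a nonzero product
  have hz₁0 : (Submodule.Quotient.mk z₁ : G.LeeH0) ≠ 0 := by rw [hz₁]; exact ha₁
  have hz₂0 : (Submodule.Quotient.mk z₂ : H.LeeH0) ≠ 0 := by rw [hz₂]; exact ha₂
  have hρz₁ : G.qProjBar ρ₁ (Submodule.Quotient.mk z₁) = Submodule.Quotient.mk z₁ := by rw [hz₁]; exact hρ₁
  have hρz₂ : H.qProjBar ρ₂ (Submodule.Quotient.mk z₂) = Submodule.Quotient.mk z₂ := by rw [hz₂]; exact hρ₂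
  have hcoord : (G.connSum H).leeCoord 0 μ ((G.connSum H).leeState₀ hpD true) ≠ 0 := by
    rw [G.leeState₀_connSum H hG hH hpG hpH hpD true, hμdef, G.leeCoord_mergeMap_glue H hG hH]
    exact mul_ne_zero (mul_ne_zero (leeSign_ne_zero _)
      (leeCoord_leeState_ne_zero_of_qProjBar_eq hpG G.arcZero hz₁0 hρz₁ true))
      (leeCoord_leeState_ne_zero_of_qProjBar_eq hpH H.arcZero hz₂0 hρz₂ true)
  have hμ0 : (Submodule.Quotient.mk (⟨μ, hμ⟩ : (G.connSum H).leeCycles) : (G.connSum H).LeeH0) ≠ 0 := by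
    intro h0
    rw [Submodule.Quotient.mk_eq_zero] at h0
    have hrange : μ ∈ LinearMap.range ((G.connSum H).khovanovD ℚ 0 1 (0 - 1) 0) := h0
    exact hcoord (((G.connSum H).mem_range_iff_leeCoord_leeState_eq_zero hpD hμ).1 hrange true)
  -- hence `s_max(G # H) ≥ n₁ + n₂ - 1`
  obtain ⟨b, hb, m, hm, hmaxD⟩ := exists_classDegree_eq_leeSMax (G := G.connSum H) ⟨_, hμ0⟩
  have h1 : qMin μ ≤ classDegree (Submodule.Quotient.mk (⟨μ, hμ⟩ : (G.connSum H).leeCycles) : (G.connSum H).LeeH0) :=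
    le_iSup₂_of_le (⟨μ, hμ⟩ : (G.connSum H).leeCycles) rfl le_rfl
  have h2 : classDegree (Submodule.Quotient.mk (⟨μ, hμ⟩ : (G.connSum H).leeCycles) : (G.connSum H).LeeH0) ≤
      (G.connSum H).leeSMax :=
    le_iSup₂_of_le (Submodule.Quotient.mk (⟨μ, hμ⟩ : (G.connSum H).leeCycles) : (G.connSum H).LeeH0) hμ0 le_rfl
  have hμle : (((n₁ + n₂ - 1 : ℤ) : WithTop ℤ) : WithBot (WithTop ℤ)) ≤ (G.connSum H).leeSMax :=
    hq.trans (h1.trans h2)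
  rw [hmaxD, WithBot.coe_le_coe, WithTop.coe_le_coe] at hμle
  rw [rasmussenInvariant_eq_of_leeSMax_eq hmax₁, rasmussenInvariant_eq_of_leeSMax_eq hmax₂,
    rasmussenInvariant_eq_of_leeSMax_eq hmaxD]
  omega

include hG hH in
/-- **Additivity of Rasmussen's `s` for diagrams: `s(G # H) = s(G) + s(H)`** for Gauss diagrams with
Gauss parity (in particular diagrams of knots) having at least one chord each (an empty summand is
the unknot, `GaussDiagram.connSum_empty`, `rasmussenInvariant_empty`). The lower bound is
`add_le_rasmussenInvariant_connSum`; the upper bound is the lower bound for the mirror images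
(`GaussDiagram.mirror_connSum`) and `s(Ḡ) = -s(G)` (`rasmussenInvariant_mirror_of_parity_self`) —
Rasmussen's "applying the same argument to `K̄₁` and `K̄₂`". This is the diagrammatic content of
Rasmussen (2010), Prop. 3.11; the knot-level named fact `HasRasmussenInvariant.add` follows once
`D₁ # D₂` is realised by a connected sum of knots realising `D₁`, `D₂`.
[cite: Rasmussen2010, Prop. 3.11] -/
theorem rasmussenInvariant_connSum (hpG : ∀ i, (G.overPos i).val % 2 ≠ (G.underPos i).val % 2)
    (hpH : ∀ j, (H.overPos j).val % 2 ≠ (H.underPos j).val % 2) :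
    (G.connSum H).rasmussenInvariant = G.rasmussenInvariant + H.rasmussenInvariant := by
  refine le_antisymm ?_ (G.add_le_rasmussenInvariant_connSum H hG hH hpG hpH)
  have h := G.mirror.add_le_rasmussenInvariant_connSum H.mirror hG hH (parity_mirror hpG) (parity_mirror hpH)
  rw [← mirror_connSum, rasmussenInvariant_mirror_of_parity_self hpG,
    rasmussenInvariant_mirror_of_parity_self hpH,
    rasmussenInvariant_mirror_of_parity_self (G.connSum_parity H hpG hpH)] at h
  linarith

/-- A Gauss diagram without chords is the empty diagram. [folklore] -/
theorem eq_empty_of_n_eq_zero {K : GaussDiagram} (h : K.n = 0) : K = GaussDiagram.empty := by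
  obtain ⟨n, ov, un, sg, bij⟩ := K
  simp only at h
  subst h
  simp only [GaussDiagram.empty, GaussDiagram.mk.injEq, heq_eq_eq, true_and]
  exact ⟨funext fun i ↦ i.elim0, funext fun i ↦ i.elim0, funext fun i ↦ i.elim0⟩

include hG in
/-- **Additivity with an empty second summand allowed**: `s(G # H) = s(G) + s(H)` for `G` with at
least one chord and any `H` (both with Gauss parity); `G # ∅ = G` and `s(∅) = 0`.
[cite: Rasmussen2010, Prop. 3.11] -/
theorem rasmussenInvariant_connSum_of_pos_left (hpG : ∀ i, (G.overPos i).val % 2 ≠ (G.underPos i).val % 2)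
    (hpH : ∀ j, (H.overPos j).val % 2 ≠ (H.underPos j).val % 2) :
    (G.connSum H).rasmussenInvariant = G.rasmussenInvariant + H.rasmussenInvariant := by
  by_cases hH : 0 < H.n
  · exact G.rasmussenInvariant_connSum H hG hH hpG hpH
  · obtain rfl : H = GaussDiagram.empty := eq_empty_of_n_eq_zero (by omega)
    rw [connSum_empty, rasmussenInvariant_empty, add_zero]

/-- **Two Gauss diagrams with the same data are equal** (the numbers of chords being propositionally
equal): a structure-equality principle along `Fin.cast`. [folklore] -/
theorem mk_eq_mk_of {n m : ℕ} (h : n = m)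
    {ov : Fin n → Fin (2 * n)} {un : Fin n → Fin (2 * n)} {sg : Fin n → ℤˣ}
    {bij : Function.Bijective (Sum.elim ov un)}
    {ov' : Fin m → Fin (2 * m)} {un' : Fin m → Fin (2 * m)} {sg' : Fin m → ℤˣ}
    {bij' : Function.Bijective (Sum.elim ov' un')}
    (hov : ∀ i : Fin n, (ov i : ℕ) = ov' (Fin.cast h i))
    (hun : ∀ i : Fin n, (un i : ℕ) = un' (Fin.cast h i))
    (hsg : ∀ i : Fin n, sg i = sg' (Fin.cast h i)) :
    (GaussDiagram.mk n ov un sg bij) = GaussDiagram.mk m ov' un' sg' bij' := by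
  subst h
  simp only [GaussDiagram.mk.injEq, heq_eq_eq, true_and]
  exact ⟨funext fun i ↦ Fin.ext (hov i), funext fun i ↦ Fin.ext (hun i), funext fun i ↦ hsg i⟩

/-- **The connected sum with the empty diagram on the left is the diagram itself** (as Gauss
diagrams: `0 + n = n` chords, positions shifted by `2 · 0`). Companion of
`GaussDiagram.connSum_empty`. [folklore] -/
theorem empty_connSum (K : GaussDiagram) : GaussDiagram.empty.connSum K = K := by
  obtain ⟨n, ov, un, sg, bij⟩ := K
  have hex : ∀ i : Fin (GaussDiagram.empty.n + n), ∃ j : Fin n, i = Fin.natAdd GaussDiagram.empty.n j :=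
    fun i ↦ ⟨⟨i, by have := i.isLt; simp [GaussDiagram.empty] at this; omega⟩,
      Fin.ext (by simp [GaussDiagram.empty])⟩
  have hc : ∀ j : Fin n, Fin.cast (Nat.zero_add n) (Fin.natAdd GaussDiagram.empty.n j) = j :=
    fun j ↦ Fin.ext (by simp [GaussDiagram.empty])
  refine mk_eq_mk_of (Nat.zero_add n) (fun i ↦ ?_) (fun i ↦ ?_) (fun i ↦ ?_)
  · obtain ⟨j, rfl⟩ := hex i
    change ((GaussDiagram.empty.connSum ⟨n, ov, un, sg, bij⟩).overPos (Fin.natAdd _ j) : ℕ) = _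
    rw [connSum_overPos_natAdd, inrPos_val, hc]
    simp [GaussDiagram.empty]
  · obtain ⟨j, rfl⟩ := hex i
    change ((GaussDiagram.empty.connSum ⟨n, ov, un, sg, bij⟩).underPos (Fin.natAdd _ j) : ℕ) = _
    rw [connSum_underPos_natAdd, inrPos_val, hc]
    simp [GaussDiagram.empty]
  · obtain ⟨j, rfl⟩ := hex i
    change (GaussDiagram.empty.connSum ⟨n, ov, un, sg, bij⟩).sign (Fin.natAdd _ j) = _
    rw [connSum_sign_natAdd, hc]

/-- **Additivity of Rasmussen's `s` for diagrams, general form: `s(G # H) = s(G) + s(H)`** for all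
Gauss diagrams `G`, `H` satisfying Gauss's parity condition (empty summands included:
`∅ # H = H`, `G # ∅ = G`, `s(∅) = 0`). Rasmussen (2010), Prop. 3.11 (for diagrams of knots).
[cite: Rasmussen2010, Prop. 3.11] -/
theorem rasmussenInvariant_connSum' (hpG : ∀ i, (G.overPos i).val % 2 ≠ (G.underPos i).val % 2)
    (hpH : ∀ j, (H.overPos j).val % 2 ≠ (H.underPos j).val % 2) :
    (G.connSum H).rasmussenInvariant = G.rasmussenInvariant + H.rasmussenInvariant := by
  by_cases hG : 0 < G.n
  · exact G.rasmussenInvariant_connSum_of_pos_left H hG hpG hpH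
  · obtain rfl : G = GaussDiagram.empty := eq_empty_of_n_eq_zero (by omega)
    rw [empty_connSum, rasmussenInvariant_empty, zero_add]

end Additivity

end GaussDiagram

end Literature.Topology.FourManifolds
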